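import Mathlib
import HarnessLib
import Summits.HubbardSuperconductivity.HubbardSuperconductivity.Theorems.KLProgrammeKLRegimeEngineScaleZeroThetaPackage
import Summits.HubbardSuperconductivity.HubbardSuperconductivity.Theorems.KLProgrammeKLRegimeEngineScaleZeroIsoTuple
import Summits.HubbardSuperconductivity.HubbardSuperconductivity.Theorems.KLProgrammeKLRegimeEngineV8DefsQ5

/-!
# K3 ENGINE child (stmt-HubbardSuperconductivity-19918), stub `stub_engine_scale0`: the values-constant smallness `klScaleZeroValC R·U ≤ 1/4`
# holds below the EXISTING engine threshold `klEngU₀3` — no package change (plan g13 ruling l.1826 (iv); cell gate-hubbard-kl, seat p3 g6)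

Companion of k3c2-p1's `…ScaleZeroThetaPackage` (`klScaleZeroThetaC_mul_le_half_of_le_klEngU₀3`).  Dyadic sizes:
`klScaleZeroValC R = 192e²·A0·CV²/κ₀⁶ ≤ 2^{105}·((Gfr0+1)(Gfr2+1))²` (`A0 ≤ 2^{43}`, `CV ≤ 2^{45}(Gfr0+1)(Gfr2+1)`, `192e² < 2^{11}`, `κ₀⁶ = 12108³ ≥ 2^{39}`),
`(Gfr0+1)(Gfr2+1) ≤ 4·Rsq²`, `U ≤ klEngU₀3 ≤ 2^{-120}/Rsq⁴` ⇒ `klScaleZeroValC R·U ≤ 2^{-11}`.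

* `klScaleZeroValC_le` — the dyadic size;
* **`klScaleZeroValC_mul_le_quarter_of_le_klEngU₀3`** — `R.WF → 0 < U ≤ klEngU₀3 P R c → klScaleZeroValC R·U ≤ 1/4`;
* **`isoTupleL1AtS_zero_of_klEngU₀3`** — p3's (E5-S)₀ closer `isoTupleL1AtS_zero_of_klEng` with BOTH package smallnesses (`θ`, `ValC`) discharged
  under `U ≤ klEngU₀3 P R c`: what remains is the isotropic torus bound `T̂` (hypothesis `hT`) and the `G`-number `T̂⁴ ≤ G.CF`.

Everything is proved; no definitions, no named facts, no sorry.
-/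

noncomputable section

namespace Summit.HubbardSuperconductivity.HubbardSuperconductivity.Theorems.EngineV8

set_option linter.dupNamespace false -- summit = problem name (single-conjunct summit), D-0017

open Real Finset Literature.MathematicalPhysics.QuantumLattice Literature.Probability.LatticeModels
open Summit.HubbardSuperconductivity.HubbardSuperconductivity.Theorems.KLRegimeSplit
open Summit.HubbardSuperconductivity.HubbardSuperconductivity.Theorems.KLProgrammeLegKernels
open scoped ComplexConjugate

/-- **`klScaleZeroValC R ≤ 2^{105}·((Gfr0+1)(Gfr2+1))²`**. -/
theorem klScaleZeroValC_le {R : RenConsts} (h0 : 0 ≤ R.Gfr 0) (h2 : 0 ≤ R.Gfr 2) :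
    klScaleZeroValC R ≤ (2 : ℝ) ^ 105 * ((R.Gfr 0 + 1) * (R.Gfr 2 + 1)) ^ 2 := by
  set b : ℝ := (R.Gfr 0 + 1) * (R.Gfr 2 + 1) with hb
  have hb0 : 0 ≤ b := by rw [hb]; positivity
  have hA := klScaleZeroA0_le_two_pow
  have hA0 := klScaleZeroA0_pos.le
  have hCV := klScaleZeroCV_le h0 h2
  rw [← hb] at hCV
  have hCV0 := (klScaleZeroCV_pos h0).le
  have hCV2 : klScaleZeroCV R ^ 2 ≤ ((2 : ℝ) ^ 45 * b) ^ 2 := pow_le_pow_left₀ hCV0 hCV 2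
  -- `192e² < 2^11`
  have he2 : Real.exp 2 < 7.39 := by
    have h := Real.exp_one_lt_d9
    have : Real.exp 2 = Real.exp 1 ^ 2 := by rw [← Real.exp_nat_mul]; norm_num
    rw [this]; nlinarith [Real.exp_pos 1]
  have he1sq : Real.exp 1 ^ 2 = Real.exp 2 := by rw [← Real.exp_nat_mul]; norm_num
  have hc : 192 * Real.exp 1 ^ 2 ≤ (2 : ℝ) ^ 11 := by rw [he1sq]; nlinarith
  -- `κ₀⁶ = 12108³ ≥ 2^39`
  have hk2 : Real.sqrt (2 * (7 + 6047)) ^ 2 = 2 * (7 + 6047) := Real.sq_sqrt (by norm_num)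
  have hk6 : Real.sqrt (2 * (7 + 6047)) ^ 6 = (2 * (7 + 6047)) ^ 3 := by
    rw [show Real.sqrt (2 * (7 + 6047)) ^ 6 = (Real.sqrt (2 * (7 + 6047)) ^ 2) ^ 3 by ring, hk2]
  have hk6ge : (2 : ℝ) ^ 39 ≤ Real.sqrt (2 * (7 + 6047)) ^ 6 := by rw [hk6]; norm_num
  have hk6pos : 0 < Real.sqrt (2 * (7 + 6047)) ^ 6 := lt_of_lt_of_le (by norm_num) hk6ge
  rw [klScaleZeroValC, div_le_iff₀ hk6pos]
  -- numerator ≤ 2^11 · 2^43 · 2^90 b² = 2^144 b²; and 2^105 b² · κ₀⁶ ≥ 2^105 b² 2^39 = 2^144 b²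
  have hnum : 192 * Real.exp 1 ^ 2 * klScaleZeroA0 * klScaleZeroCV R ^ 2 ≤ (2 : ℝ) ^ 11 * (2 : ℝ) ^ 43 * ((2 : ℝ) ^ 45 * b) ^ 2 := by
    have h1 : 192 * Real.exp 1 ^ 2 * klScaleZeroA0 ≤ (2 : ℝ) ^ 11 * (2 : ℝ) ^ 43 :=
      mul_le_mul hc hA hA0 (by positivity)
    exact mul_le_mul h1 hCV2 (by positivity) (by positivity)
  have hb2 : 0 ≤ b ^ 2 := by positivity
  calc 192 * Real.exp 1 ^ 2 * klScaleZeroA0 * klScaleZeroCV R ^ 2 ≤ (2 : ℝ) ^ 11 * (2 : ℝ) ^ 43 * ((2 : ℝ) ^ 45 * b) ^ 2 := hnum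
    _ = (2 : ℝ) ^ 105 * b ^ 2 * (2 : ℝ) ^ 39 := by ring
    _ ≤ (2 : ℝ) ^ 105 * b ^ 2 * Real.sqrt (2 * (7 + 6047)) ^ 6 := mul_le_mul_of_nonneg_left hk6ge (by positivity)

/-- **The values-constant smallness below the engine threshold**: `R.WF`, `0 < U ≤ klEngU₀3 P R c` ⇒ `klScaleZeroValC R · U ≤ 1/4`
(in fact `≤ 2^{-11}`). -/
theorem klScaleZeroValC_mul_le_quarter_of_le_klEngU₀3 {P : SplitConsts} {R : RenConsts} (hR : R.WF) {c U : ℝ} (hU : 0 < U)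
    (hU₀ : U ≤ klEngU₀3 P R c) : klScaleZeroValC R * U ≤ 1 / 4 := by
  have hG := hR.2.2
  have hV := klScaleZeroValC_le (hG 0) (hG 2)
  have hV0 := (klScaleZeroValC_pos (hG 0)).le
  have hRsq1 : 1 ≤ klEngRsq R := one_le_klEngRsq R
  have hPsq1 : 1 ≤ klEngPsq P := one_le_klEngPsq P
  have hG0 : R.Gfr 0 ≤ klEngRsq R := gfr_le_klEngRsq R (by norm_num)
  have hG2 : R.Gfr 2 ≤ klEngRsq R := gfr_le_klEngRsq R (by norm_num)
  have hden : (2 : ℝ) ^ 120 * klEngRsq R ^ 4 ≤ (2 : ℝ) ^ 120 * klEngPsq P ^ 2 * klEngRsq R ^ 4 * (c ^ 2 + 1) := by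
    have h2' : (1 : ℝ) ≤ klEngPsq P ^ 2 := one_le_pow₀ hPsq1
    have h3 : (1 : ℝ) ≤ c ^ 2 + 1 := by nlinarith [sq_nonneg c]
    have hR0 : 0 ≤ klEngRsq R ^ 4 := by positivity
    calc (2 : ℝ) ^ 120 * klEngRsq R ^ 4 = (2 : ℝ) ^ 120 * 1 * klEngRsq R ^ 4 * 1 := by ring
      _ ≤ _ := by gcongr
  have hUle : U ≤ 1 / ((2 : ℝ) ^ 120 * klEngRsq R ^ 4) := by
    refine hU₀.trans ?_
    rw [klEngU₀3]
    exact one_div_le_one_div_of_le (by positivity) hden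
  have hb : (R.Gfr 0 + 1) * (R.Gfr 2 + 1) ≤ 4 * klEngRsq R ^ 2 := by nlinarith [hG 0, hG 2]
  have hb2 : ((R.Gfr 0 + 1) * (R.Gfr 2 + 1)) ^ 2 ≤ (4 * klEngRsq R ^ 2) ^ 2 :=
    pow_le_pow_left₀ (by have := hG 0; have := hG 2; positivity) hb 2
  calc klScaleZeroValC R * U ≤ ((2 : ℝ) ^ 105 * (4 * klEngRsq R ^ 2) ^ 2) * (1 / ((2 : ℝ) ^ 120 * klEngRsq R ^ 4)) :=
        mul_le_mul (hV.trans (by nlinarith)) hUle hU.le (by positivity)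
    _ = 1 / (2 : ℝ) ^ 11 := by field_simp; ring
    _ ≤ 1 / 4 := by norm_num

/-- **(E5-S)₀ under the ENGINE's binders with both package smallnesses discharged** (`θ` by k3c2-p1's
`klScaleZeroThetaC_mul_le_half_of_le_klEngU₀3`, `ValC` by the above): `R.WF`, `0 < U ≤ klEngU₀3 P R c`, `klBetaMin ≤ β`,
`FrameOK R U (nScales β) μ K`, `klEngL₃ β U ≤ L`, `klEngM₃ β U L ≤ M`, the isotropic torus bound `T̂` and the `G`-number `T̂⁴ ≤ G.CF` ⟹
`IsoTupleL1AtS L M G P β U μ K 0`. -/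
theorem isoTupleL1AtS_zero_of_klEngU₀3 {L M : ℕ} [NeZero L] [NeZero M] {G : GeoConsts} {P : SplitConsts} {R : RenConsts} (hR : R.WF)
    {c U : ℝ} (hU : 0 < U) (hU₀ : U ≤ klEngU₀3 P R c) {μ : ℝ} {K : TrigPolyC4v} {β : ℝ} (hβ : klBetaMin ≤ β)
    (hK : FrameOK R U (nScales β) μ K) (hL : klEngL₃ β U ≤ L) (hM : klEngM₃ β U L ≤ M)
    {Th : ℝ} (hTh0 : 0 ≤ Th)
    (hT : ∀ (m : ℕ) (ω : Fin (sectorCount (2 * m))) (c' : Fin 2), 1 / (|β| * (L : ℝ) ^ 2) *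
        ∑ dw : TorusSite 1 (2 * (2 * M)) × TorusSite 2 L, ‖∑ k : FreqMomentum L M, klIsoFamily L M β μ K klE0 m ω k *
          (if c' = 0 then torusChar (fun _ : Fin 1 => ((k.1 : ℕ) : ZMod (2 * (2 * M)))) dw.1 * torusChar k.2 dw.2
            else conj (torusChar (fun _ : Fin 1 => ((k.1 : ℕ) : ZMod (2 * (2 * M)))) dw.1 * torusChar k.2 dw.2))‖ ≤
        Th / imagTimeWeight β M)
    (hCF : Th ^ 4 ≤ G.CF) :
    IsoTupleL1AtS L M G P β U μ K 0 :=
  isoTupleL1AtS_zero_of_klEng hR hU (le_one_of_le_klEngU₀3 hU₀) hβ hK hL hM (klScaleZeroThetaC_mul_le_half_of_le_klEngU₀3 hR hU hU₀)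
    (klScaleZeroValC_mul_le_quarter_of_le_klEngU₀3 hR hU hU₀) hTh0 hT hCF

end Summit.HubbardSuperconductivity.HubbardSuperconductivity.Theorems.EngineV8

end
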